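import Summits.Ventures.WeilGRH.TwistedMomentCertOddSound
import Summits.Ventures.WeilGRH.TwistedMomentDirichlet
import HarnessLib

/-!
# Twisted moment certificates, odd characters (V): from a checked odd certificate to the rung of `L(s, χ)`

Cell `rh-explicit`, WEIL TRACK — GRH ARM (namespace `Summit.Ventures.WeilGRH`).  For an ODD character `χ` mod `q ≠ 1`
with real `χ(2) = s ∈ {−1, 0, 1}` the weight of `E_{χ,2}` splits as
`M_{χ,2}(τ) = (log q − log π) + twistWeight s τ + π sech(πτ)` (`re_digamma_par_one_sub_zero`): the even part is
minorised by the twisted cells (`checkCellsZS`, file II), the parity bonus is the position-space functional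
`Re ∫ (g ⋆ g̃)(w) dw/(2cosh(w/2))` (`integral_weilMellin_mul_sech_eq`, `WeilExplicitArchParitySech.lean`), and
`TwistCertOdd.form_nonneg_of_check` bounds the sum from below by `0`.  Results:
`weilFinitePrimeQuadraticChar_nonneg_of_twistCertOdd`, **`weilPositivityOnChar_of_twistCertOdd`**,
`weilPositivityOnChar_log_three_half_of_twistCertOdd` — so a kernel evaluation of `checkCellsZS` and `checkAlgOdd`
on certificate DATA proves the `(log 3)/2` rung for the odd classes `3.2` (`s = −1`), `4.3` (`s = 0`), `7.6` (`s = 1`).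
Everything here is PROVED; no named facts; nothing about zeros of `L(s, χ)`.
-/

noncomputable section

open Complex Finset MeasureTheory Set Filter
open scoped Real Topology ComplexConjugate BigOperators

namespace Summit.Ventures.WeilGRH

open Literature.NumberTheory.LFunctions Literature.NumberTheory.LFunctions.WeilArchParity
open Literature.Analysis.ValidatedNumerics.Numerics
open Literature.Analysis.SpecialFunctions

variable {q : ℕ}

/-- For an odd character the finite-prime weight minus its level is the twisted even model weight plus the
parity bonus: `M_{χ,2}(τ) − (log q − log π) = twistWeight s τ + π/cosh(πτ)` (`χ(2) = s`). [folklore] -/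
theorem weilFinitePrimeWeightChar_sub_eq_of_odd (χ : DirichletCharacter ℂ q) {s : ℤ}
    (hχ2 : χ ((2 : ℕ) : ZMod q) = (s : ℂ)) (hodd : charParity χ = 1) (τ : ℝ) :
    weilFinitePrimeWeightChar χ 2 τ - (Real.log q - Real.log π) =
      twistWeight s τ + π / Real.cosh (π * τ) := by
  unfold weilFinitePrimeWeightChar twistWeight reDigammaQuarter
  rw [weilPrimeRippleChar_two_of_chi_two χ hχ2 τ, hodd]
  have h := re_digamma_par_one_sub_zero τ
  have e0 : (1 / 4 + ((0 : ℕ) : ℂ) / 2 + τ / 2 * I : ℂ) = 1 / 4 + (τ : ℂ) / 2 * I := by push_cast; ring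
  rw [e0] at h
  linarith

/-- The parity bonus on the frequency side is the position-space `sech(x/2)/2` functional of `g ⋆ g̃`:
`(1/2π) ∫ |ĝ(1/2+it)|² π/cosh(πt) dt = Re ∫ (g ⋆ g̃)(w) dw/(2cosh(w/2))`. [folklore] -/
theorem bonus_freq_eq_position {g : ℝ → ℂ} (hg : IsWeilTest g) :
    1 / (2 * π) * ∫ t : ℝ, ‖weilMellin g (1 / 2 + t * I)‖ ^ 2 * (π / Real.cosh (π * t)) =
      (∫ w : ℝ, weilConv g (weilReflect g) w * (((1 / (2 * Real.cosh (w / 2)) : ℝ) : ℂ))).re := by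
  have hk : IsWeilTest (weilConv g (weilReflect g)) := hg.weilConv hg.weilReflect
  have h := integral_weilMellin_mul_sech_eq hk
  have hl : (∫ t : ℝ, weilMellin (weilConv g (weilReflect g)) (1 / 2 + t * I) *
      ((π / Real.cosh (π * t) : ℝ) : ℂ)) =
      ((∫ t : ℝ, ‖weilMellin g (1 / 2 + t * I)‖ ^ 2 * (π / Real.cosh (π * t)) : ℝ) : ℂ) := by
    rw [← integral_complex_ofReal]
    refine integral_congr_ae (Eventually.of_forall fun t ↦ ?_)
    simp only
    rw [weilMellin_weilConv_weilReflect_half hg t]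
    push_cast
    ring
  have hr : (∫ x : ℝ, weilConv g (weilReflect g) x / (2 * Real.cosh (x / 2) : ℂ)) =
      (∫ w : ℝ, weilConv g (weilReflect g) w * (((1 / (2 * Real.cosh (w / 2)) : ℝ) : ℂ))) := by
    refine integral_congr_ae (Eventually.of_forall fun w ↦ ?_)
    have hc : (Real.cosh (w / 2) : ℂ) ≠ 0 := by exact_mod_cast (Real.cosh_pos _).ne'
    simp only
    push_cast
    field_simp
  rw [hl, hr] at h
  have h2 := congrArg Complex.re h
  rw [Complex.ofReal_re, show (2 * (π : ℂ)) = ((2 * π : ℝ) : ℂ) from by push_cast; ring, Complex.re_ofReal_mul] at h2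
  have hπ : (2 * π : ℝ) ≠ 0 := by positivity
  rw [h2, ← mul_assoc, one_div_mul_cancel hπ, one_mul]

/-- **`E_{χ,2} ≥ 0` on `C(b)` from a checked ODD certificate.** For an odd `χ` mod `q` with `χ(2) = s`, cells
accepted by `checkCellsZS s p j`, an odd certificate accepted by `checkAlgOdd`, and `ellLo ≤ log q − log π`:
`0 ≤ E_{χ,2}(g)` for every test function `g` with `tsupport g ⊆ [−b, b]`. [folklore] -/
theorem weilFinitePrimeQuadraticChar_nonneg_of_twistCertOdd (c : TwistCertOdd) {s : ℤ} {p j M : ℕ}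
    (hcells : checkCellsZS s p j c.cert.base.wL c.cert.base.T M c.cert.cells = true)
    (halg : c.checkAlgOdd = true)
    (χ : DirichletCharacter ℂ q) (hχ2 : χ ((2 : ℕ) : ZMod q) = (s : ℂ)) (hodd : charParity χ = 1)
    (hℓ : ((c.cert.ellLo : ℚ) : ℝ) ≤ Real.log q - Real.log π)
    {g : ℝ → ℂ} (hg : IsWeilTest g) (hsupp : tsupport g ⊆ Icc (-(c.cert.b : ℝ)) c.cert.b) :
    0 ≤ weilFinitePrimeQuadraticChar χ 2 g := by
  have hOK := cellsOKW_of_checkCellsZS hcells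
  set W : ℝ → ℝ := twistWeight s with hW
  set B : ℝ → ℝ := fun t ↦ π / Real.cosh (π * t) with hB
  have hWi : Integrable fun t : ℝ ↦ ‖weilMellin g (1 / 2 + t * I)‖ ^ 2 * W t := by
    have h1 := integrable_norm_sq_weilMellin_mul_reDigammaQuarter hg
    have h2 : Integrable fun t : ℝ ↦ ‖weilMellin g (1 / 2 + t * I)‖ ^ 2 *
        ((s : ℝ) * (-(Real.sqrt 2 * Real.log 2 * Real.cos (t * Real.log 2)))) :=
      integrable_norm_sq_weilMellin_mul hg (by fun_prop) (A := |(s : ℝ)| * (Real.sqrt 2 * Real.log 2)) (B := 0)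
        (by positivity) le_rfl fun t ↦ by
          rw [zero_mul, add_zero, abs_mul, abs_neg, abs_mul,
            abs_of_nonneg (by positivity : (0 : ℝ) ≤ Real.sqrt 2 * Real.log 2)]
          exact mul_le_mul_of_nonneg_left (mul_le_of_le_one_right (by positivity) (Real.abs_cos_le_one _))
            (abs_nonneg _)
    refine (h1.add h2).congr (Eventually.of_forall fun t ↦ ?_)
    simp only [Pi.add_apply, hW, twistWeight]
    ring
  have hBi : Integrable fun t : ℝ ↦ ‖weilMellin g (1 / 2 + t * I)‖ ^ 2 * B t :=
    integrable_norm_sq_weilMellin_mul hg (by fun_prop) (A := π) (B := 0) Real.pi_pos.le le_rfl fun t ↦ by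
      rw [zero_mul, add_zero, hB]
      simp only
      rw [abs_div, abs_of_pos Real.pi_pos, abs_of_pos (Real.cosh_pos _)]
      exact div_le_self Real.pi_pos.le (Real.one_le_cosh _)
  have hmain := TwistCertOdd.form_nonneg_of_check_mono halg hOK (twistWeight_neg s) (fun _ ↦ le_rfl) hℓ hg hWi hsupp
  -- `E_{χ,2}(g) = ℓ‖g‖₂² + (1/2π)∫|ĝ|² W + (1/2π)∫|ĝ|² B`
  have hsplit : weilFinitePrimeQuadraticChar χ 2 g =
      (Real.log q - Real.log π) * weilNorm2Sq g +
        1 / (2 * π) * (∫ t : ℝ, ‖weilMellin g (1 / 2 + t * I)‖ ^ 2 * W t) +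
        1 / (2 * π) * ∫ t : ℝ, ‖weilMellin g (1 / 2 + t * I)‖ ^ 2 * B t := by
    unfold weilFinitePrimeQuadraticChar
    have h1 := integrable_norm_sq_weilMellin_half_line hg
    have e : (fun τ : ℝ ↦ ‖weilMellin g (1 / 2 + τ * I)‖ ^ 2 * weilFinitePrimeWeightChar χ 2 τ) =
        fun τ : ℝ ↦ (‖weilMellin g (1 / 2 + τ * I)‖ ^ 2 * W τ + ‖weilMellin g (1 / 2 + τ * I)‖ ^ 2 * B τ) +
          (Real.log q - Real.log π) * ‖weilMellin g (1 / 2 + τ * I)‖ ^ 2 := by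
      funext τ
      have := weilFinitePrimeWeightChar_sub_eq_of_odd χ hχ2 hodd τ
      rw [hW, hB]; simp only
      linear_combination (‖weilMellin g (1 / 2 + τ * I)‖ ^ 2) * this
    have hWB : Integrable fun t : ℝ ↦
        ‖weilMellin g (1 / 2 + t * I)‖ ^ 2 * W t + ‖weilMellin g (1 / 2 + t * I)‖ ^ 2 * B t := hWi.add hBi
    rw [e, integral_add hWB (h1.const_mul _), integral_add hWi hBi, integral_const_mul,
      integral_norm_sq_weilMellin_half_line hg]
    set X := ∫ t : ℝ, ‖weilMellin g (1 / 2 + t * I)‖ ^ 2 * W t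
    set Y := ∫ t : ℝ, ‖weilMellin g (1 / 2 + t * I)‖ ^ 2 * B t
    have hπ : (π : ℝ) ≠ 0 := Real.pi_ne_zero
    field_simp
    ring
  rw [hsplit, hB]
  simp only
  rw [bonus_freq_eq_position hg]
  exact hmain

/-- **The rung from a checked odd certificate**: `WeilPositivityOnChar χ t` for every `t ≤ b` with `e^{2t} ≤ 3`,
`χ` odd mod `q ≠ 1`, `χ(2) = s`. [folklore] -/
theorem weilPositivityOnChar_of_twistCertOdd (c : TwistCertOdd) {s : ℤ} {p j M : ℕ}
    (hcells : checkCellsZS s p j c.cert.base.wL c.cert.base.T M c.cert.cells = true)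
    (halg : c.checkAlgOdd = true) (hq : q ≠ 1) (χ : DirichletCharacter ℂ q)
    (hχ2 : χ ((2 : ℕ) : ZMod q) = (s : ℂ)) (hodd : charParity χ = 1)
    (hℓ : ((c.cert.ellLo : ℚ) : ℝ) ≤ Real.log q - Real.log π)
    {t : ℝ} (htb : t ≤ (c.cert.b : ℝ)) (ht3 : Real.exp (2 * t) ≤ 3) :
    WeilPositivityOnChar χ t := by
  intro g hg hsupp
  have h3 : Real.exp (2 * t) ≤ ((2 : ℕ) : ℝ) + 1 := by norm_num; exact ht3
  rw [weilQuadraticChar_re_eq_weilFinitePrimeQuadraticChar hq χ hg h3 hsupp]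
  exact weilFinitePrimeQuadraticChar_nonneg_of_twistCertOdd c hcells halg χ hχ2 hodd hℓ hg
    (hsupp.trans (Icc_subset_Icc (by linarith) htb))

/-- **The `(log 3)/2` rung from a checked odd certificate** with `logThreeHiQ/2 ≤ b`. [folklore] -/
theorem weilPositivityOnChar_log_three_half_of_twistCertOdd (c : TwistCertOdd) {s : ℤ} {p j M : ℕ}
    (hcells : checkCellsZS s p j c.cert.base.wL c.cert.base.T M c.cert.cells = true)
    (halg : c.checkAlgOdd = true) (hb : logThreeHiQ / 2 ≤ c.cert.b)
    (hq : q ≠ 1) (χ : DirichletCharacter ℂ q) (hχ2 : χ ((2 : ℕ) : ZMod q) = (s : ℂ))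
    (hodd : charParity χ = 1) (hℓ : ((c.cert.ellLo : ℚ) : ℝ) ≤ Real.log q - Real.log π) :
    WeilPositivityOnChar χ (Real.log 3 / 2) := by
  refine weilPositivityOnChar_of_twistCertOdd c hcells halg hq χ hχ2 hodd hℓ ?_ ?_
  · have h1 : Real.log 3 ≤ ((logThreeHiQ : ℚ) : ℝ) := logThree_le
    have h2 : (((logThreeHiQ / 2 : ℚ)) : ℝ) ≤ c.cert.b := by exact_mod_cast hb
    push_cast at h2
    linarith
  · rw [show 2 * (Real.log 3 / 2) = Real.log 3 by ring, Real.exp_log (by norm_num)]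

end Summit.Ventures.WeilGRH

end
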